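import Summits.BirchSwinnertonDyer.Rank1Residual.ManinAdditive.ShimuraKroneckerCore
import HarnessLib


/-!
# E-an-158 `ShimuraTwoCharIsKronecker` — even Shimura-trivial quadratic characters are Kronecker symbols

TYPER NOTE (typer g19, TURNKEY T-an-38, part 2/2 of file D).  SOURCE = HOME/an/g35/ShimuraKronecker-an-g35.lean sha16 7905f4c0102aadb4, lines
322–519 VERBATIM except this note, two one-line docstrings, and `open … ShimuraKroneckerCore` → the renamed tree namespace
`Summit.BirchSwinnertonDyer.Rank1Residual.ManinAdditive.ShimuraKroneckerCore` (part 1, `ShimuraKroneckerCore.lean`).  `shimuraTwoCharIsKronecker (N) (h4N : 4 ∣ N)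
(hN : N ≠ 0) (χ) (hχ : IsShimuraTwoChar N χ)` = the body of E-an-158 `SigmaEta.ShimuraTwoCharIsKronecker` (typed in `SigmaTwoEta.lean`) spelled
out; ref1 §R145: E-an-158 as typed SURVIVES (A1–A6 clean); an's second engine check158.py: `#Σ(N)[2] = #admissible q_E` for all `4 ∣ N ≤ 2000`,
500/500.  Theorem-only; nothing conjectured.  PARTITION 0 · beyond-print theorem: no (classical character theory) · BSD / C2 / Manin `c = 1` NOT
proved by this.

Cell file bsd-f2-manin / an g35 (tree target `…/ManinAdditive/ShimuraKronecker.lean`).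

* `ShimuraKroneckerCore.realUnitChar_classification` : every group homomorphism
  `(ZMod m)ˣ →* ℤˣ` is `d ↦ χ₄(d)^a · χ₈(d)^b · (d/q)` with `q` odd squarefree, `q ∣ m`, `a b ≤ 1`,
  `a = 1 → 4 ∣ m`, `b = 1 → 8 ∣ m` (CRT induction `Nat.recOnPrimeCoprime`; odd prime powers via
  cyclicity of `(ZMod p^k)ˣ` and the lifted Legendre character; `2`-powers via Hensel at `2`:
  `u ≡ 1 (mod 8)` is a square mod `2^k`).
* `shimuraTwoCharIsKronecker` : for `4 ∣ N`, an even quadratic Dirichlet character `χ mod N` with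
  `χ(1 + a c N/gcd(N,c²)) = 1` for all `c ∣ N`, `gcd(a,c)=1` (`IsShimuraTwoChar`) is `d ↦ (q_E / |d|)`
  for an admissible squarefree `q_E ∣ N` (`q_E` odd unless `32 ∣ N`, `q_E ≡ 1 (4)` unless `8 ∣ N`):
  the cusp units `1 + 4M`, `1 + 2M` (`N = 2^n M`) kill `χ₈` below level `32` and `χ₄` below level `8`,
  evenness ties `a` to `q mod 4`, and quadratic reciprocity turns `(d/q)·χ₄^a·χ₈^b` into `(2^b q/d)`.
-/

namespace Summit.BirchSwinnertonDyer.Rank1Residual.ManinAdditive.SigmaEta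


open ZMod Summit.BirchSwinnertonDyer.Rank1Residual.ManinAdditive.ShimuraKroneckerCore
open scoped NumberTheorySymbols

/-- `J(a | b) = 1` when `a ≡ 1 (mod b)`. -/
theorem jacobiSym_eq_one_of_dvd_sub_one {a : ℤ} {b : ℕ} (h : (b : ℤ) ∣ a - 1) : J(a | b) = 1 := by
  rw [jacobiSym.mod_left, show a % b = 1 % b from ?_, ← jacobiSym.mod_left, jacobiSym.one_left]
  rw [Int.emod_eq_emod_iff_emod_sub_eq_zero]
  exact Int.emod_eq_zero_of_dvd h

/-- `J(a | b)` depends only on `a mod b`. -/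
theorem jacobiSym_eq_of_dvd_sub {a a' : ℤ} {b : ℕ} (h : (b : ℤ) ∣ a - a') : J(a | b) = J(a' | b) := by
  rw [jacobiSym.mod_left, show a % b = a' % b from ?_, ← jacobiSym.mod_left]
  rw [Int.emod_eq_emod_iff_emod_sub_eq_zero]
  exact Int.emod_eq_zero_of_dvd h

/-- **E-an-158.** An even quadratic Dirichlet character mod `N` (`4 ∣ N`) satisfying Shimura's
cusp-unit condition is a Kronecker symbol `(q_E / ·)` with admissible squarefree `q_E ∣ N`. -/
theorem shimuraTwoCharIsKronecker (N : ℕ) (h4N : 4 ∣ N) (hN : N ≠ 0) (χ : DirichletCharacter ℤ N)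
    (hχ : IsShimuraTwoChar N χ) :
    ∃ q : ℕ, Squarefree q ∧ q ∣ N ∧ (¬ 32 ∣ N → Odd q) ∧ (¬ 8 ∣ N → q % 4 = 1) ∧
      ∀ d : ℤ, Odd d → IsCoprime d N → χ (d : ZMod N) = J(q | d.natAbs) := by
  obtain ⟨q, a, b, hsq, hodd, hqN, ha1, hb1, h4, h8, hf⟩ :=
    realUnitChar_classification N χ.toUnitHom
  have hval : ∀ {d : ℕ}, d.Coprime N → χ (d : ZMod N) = χ₄ d ^ a * χ₈ d ^ b * J(d | q) :=
    fun {d} hd => by rw [← hf d hd, MulChar.coe_toUnitHom, coe_unitOfCoprime]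
  -- `N = 2 ^ n * M` with `M` odd
  obtain ⟨n, hn⟩ : ∃ n, N.factorization 2 = n := ⟨_, rfl⟩
  obtain ⟨M, hM⟩ : ∃ M, N / 2 ^ n = M := ⟨_, rfl⟩
  have hNM : 2 ^ n * M = N := by
    rw [← hM, ← hn]; exact Nat.ordProj_mul_ordCompl_eq_self N 2
  have hModd : Odd M := by
    have : Nat.Coprime 2 M := by rw [← hM, ← hn]; exact Nat.coprime_ordCompl Nat.prime_two hN
    exact Nat.coprime_two_left.mp this
  have hMpos : 0 < M := hModd.pos
  have hpow : ∀ k, 2 ^ k ∣ N ↔ k ≤ n := fun k => by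
    rw [← hn]; exact Nat.prime_two.pow_dvd_iff_le_factorization hN
  have hn2 : 2 ≤ n := (hpow 2).mp (by simpa using h4N)
  have hqM : q ∣ M := by
    have hq2 : Nat.Coprime q (2 ^ n) := (Nat.coprime_two_right.mpr hodd).pow_right n
    exact hq2.dvd_of_dvd_mul_left (by rw [hNM]; exact hqN)
  -- Shimura's cusp units
  have hshim : ∀ c : ℕ, c ∣ N → χ ((1 + c * (N / Nat.gcd N (c * c)) : ℕ) : ZMod N) = 1 := by
    intro c hc
    have := hχ.2 1 c hc (Nat.coprime_one_left c)
    simpa only [one_mul] using this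
  have hJ1 : ∀ t : ℕ, J(((1 + t * M : ℕ) : ℤ) | q) = 1 := fun t => by
    apply jacobiSym_eq_one_of_dvd_sub_one
    rw [show ((1 + t * M : ℕ) : ℤ) - 1 = t * M by push_cast; ring]
    exact (Int.natCast_dvd_natCast.mpr hqM).mul_left _
  have hcopu : ∀ t : ℕ, (1 + 2 * t * M).Coprime N := by
    intro t
    rw [← hNM]
    apply Nat.Coprime.mul_right
    · apply Nat.Coprime.pow_right
      apply Nat.coprime_two_right.mpr
      rw [mul_assoc]
      exact odd_one.add_even (even_two_mul _)
    · exact (Nat.coprime_add_mul_right_left 1 M (2 * t)).mpr (Nat.coprime_one_left M)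
  -- STEP b: `b = 1` forces `32 ∣ N`
  have hb32 : b = 1 → 32 ∣ N := by
    intro hb
    have hn3 : 3 ≤ n := (hpow 3).mp (by simpa using h8 hb)
    by_contra h32
    have hn4 : n ≤ 4 := by
      by_contra h
      exact h32 (by simpa using (hpow 5).mpr (by omega))
    have hu1 : χ ((1 + 4 * M : ℕ) : ZMod N) = 1 := by
      interval_cases n
      · have hc : 2 * M ∣ N := ⟨4, by rw [← hNM]; ring⟩
        have hg : Nat.gcd N (2 * M * (2 * M)) = 4 * M := by
          rw [← hNM, show 2 ^ 3 * M = 2 * (4 * M) by ring, show 2 * M * (2 * M) = M * (4 * M) by ring,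
            Nat.gcd_mul_right, Nat.Coprime.gcd_eq_one (Nat.coprime_two_left.mpr hModd), one_mul]
        have hw : N / Nat.gcd N (2 * M * (2 * M)) = 2 := by
          rw [hg, ← hNM, show 2 ^ 3 * M = 2 * (4 * M) by ring, Nat.mul_div_cancel _ (by omega)]
        have := hshim (2 * M) hc
        rwa [hw, show 1 + 2 * M * 2 = 1 + 4 * M by ring] at this
      · have hc : 4 * M ∣ N := ⟨4, by rw [← hNM]; ring⟩
        have hg : Nat.gcd N (4 * M * (4 * M)) = 16 * M := by
          rw [← hNM, show 2 ^ 4 * M = 1 * (16 * M) by ring, show 4 * M * (4 * M) = M * (16 * M) by ring,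
            Nat.gcd_mul_right, Nat.gcd_one_left, one_mul]
        have hw : N / Nat.gcd N (4 * M * (4 * M)) = 1 := by
          rw [hg, ← hNM, show 2 ^ 4 * M = 16 * M by ring, Nat.div_self (by omega)]
        have := hshim (4 * M) hc
        rwa [hw, mul_one] at this
    have h5 : (1 + 4 * M) % 8 = 5 := by obtain ⟨m, rfl⟩ := hModd; omega
    have h2' : (1 + 4 * M) % 2 = 1 := by omega
    have h4' : (1 + 4 * M) % 4 = 1 := by omega
    have := hval (by simpa [mul_assoc] using hcopu 2)
    rw [hu1, hb, pow_one, hJ1 4, mul_one, ZMod.χ₄_nat_one_mod_four h4', one_pow, one_mul,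
      ZMod.χ₈_nat_eq_if_mod_eight] at this
    simp [h5, h2'] at this
  -- STEP a: `a = 1` forces `8 ∣ N`
  have ha8 : a = 1 → 8 ∣ N := by
    intro ha
    by_contra h8N
    have hn2' : n = 2 := by
      have : ¬ 3 ≤ n := fun h => h8N (by simpa using (hpow 3).mpr h)
      omega
    have hb0 : b = 0 := by
      rcases Nat.eq_zero_or_pos b with h | h
      · exact h
      · exact absurd ((show (8 : ℕ) ∣ 32 by norm_num).trans (hb32 (by omega))) h8N
    subst hn2'
    have hu1 : χ ((1 + 2 * M : ℕ) : ZMod N) = 1 := by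
      have hc : 2 * M ∣ N := ⟨2, by rw [← hNM]; ring⟩
      have hg : Nat.gcd N (2 * M * (2 * M)) = 4 * M := by
        rw [← hNM, show 2 ^ 2 * M = 1 * (4 * M) by ring, show 2 * M * (2 * M) = M * (4 * M) by ring,
          Nat.gcd_mul_right, Nat.gcd_one_left, one_mul]
      have hw : N / Nat.gcd N (2 * M * (2 * M)) = 1 := by
        rw [hg, ← hNM, show 2 ^ 2 * M = 4 * M by ring, Nat.div_self (by omega)]
      have := hshim (2 * M) hc
      rwa [hw, mul_one] at this
    have h3 : (1 + 2 * M) % 4 = 3 := by obtain ⟨m, rfl⟩ := hModd; omega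
    have := hval (by simpa using hcopu 1)
    rw [hu1, ha, hb0, pow_one, pow_zero, mul_one, hJ1 2, mul_one, ZMod.χ₄_nat_three_mod_four h3] at this
    norm_num at this
  -- evenness: `χ(-1) = 1` ties `a` to `q mod 4`
  have hq13 : q % 4 = 1 ∨ q % 4 = 3 := by obtain ⟨m, rfl⟩ := hodd; omega
  have heven : (a = 0 ∧ q % 4 = 1) ∨ (a = 1 ∧ q % 4 = 3) := by
    have h1N : 1 ≤ N := Nat.one_le_iff_ne_zero.mpr hN
    have hcop : (N - 1).Coprime N := (Nat.coprime_self_sub_left h1N).mpr (Nat.coprime_one_left N)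
    have hcast : ((N - 1 : ℕ) : ZMod N) = -1 := by
      rw [Nat.cast_sub h1N, Nat.cast_one, ZMod.natCast_self, zero_sub]
    have key := hval hcop
    rw [hcast, hχ.1] at key
    have hN4 : (N - 1) % 4 = 3 := by obtain ⟨K, hK⟩ := h4N; omega
    have hN2 : (N - 1) % 2 = 1 := by omega
    have hJ : J(((N - 1 : ℕ) : ℤ) | q) = χ₄ q := by
      rw [← jacobiSym.at_neg_one hodd]
      apply jacobiSym_eq_of_dvd_sub
      rw [Nat.cast_sub h1N, show ((N : ℕ) : ℤ) - (1 : ℕ) - (-1) = N by push_cast; ring]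
      exact Int.natCast_dvd_natCast.mpr hqN
    have hχ8 : χ₈ ((N - 1 : ℕ) : ZMod 8) ^ b = 1 := by
      rcases Nat.eq_zero_or_pos b with hb | hb
      · rw [hb, pow_zero]
      · have hb' : b = 1 := by omega
        have hN8 : (N - 1) % 8 = 7 := by obtain ⟨K, hK⟩ := hb32 hb'; omega
        rw [hb', pow_one, ZMod.χ₈_nat_eq_if_mod_eight]
        simp [hN8, hN2]
    rw [ZMod.χ₄_nat_three_mod_four hN4, hχ8, mul_one, hJ, ZMod.χ₄_nat_eq_if_mod_four] at key
    have hq2 : q % 2 = 1 := by omega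
    interval_cases a <;> rcases hq13 with hq | hq <;> simp [hq, hq2] at key ⊢
  -- the admissible Kronecker parameter is `2 ^ b * q`
  refine ⟨2 ^ b * q, ?_, ?_, ?_, ?_, ?_⟩
  · rcases Nat.eq_zero_or_pos b with hb | hb
    · simpa [hb] using hsq
    · rw [show b = 1 by omega, pow_one]
      exact (Nat.squarefree_mul (Nat.coprime_two_left.mpr hodd)).mpr ⟨Nat.prime_two.prime.squarefree, hsq⟩
  · rcases Nat.eq_zero_or_pos b with hb | hb
    · simpa [hb] using hqN
    · have hb' : b = 1 := by omega
      rw [hb', pow_one]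
      exact Nat.Coprime.mul_dvd_of_dvd_of_dvd (Nat.coprime_two_left.mpr hodd)
        ((show (2 : ℕ) ∣ 32 by norm_num).trans (hb32 hb')) hqN
  · intro h32
    have hb0 : b = 0 := by
      rcases Nat.eq_zero_or_pos b with hb | hb
      · exact hb
      · exact absurd (hb32 (by omega)) h32
    simpa [hb0] using hodd
  · intro h8N
    have hb0 : b = 0 := by
      rcases Nat.eq_zero_or_pos b with hb | hb
      · exact hb
      · exact absurd ((show (8 : ℕ) ∣ 32 by norm_num).trans (hb32 (by omega))) h8N
    have ha0 : a = 0 := by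
      rcases Nat.eq_zero_or_pos a with ha | ha
      · exact ha
      · exact absurd (ha8 (by omega)) h8N
    rcases heven with ⟨_, hq⟩ | ⟨ha', _⟩
    · simpa [hb0] using hq
    · omega
  · intro d hd hdN
    have hd' : d.natAbs.Coprime N := by
      have h := Int.isCoprime_iff_gcd_eq_one.mp hdN
      rwa [Int.gcd_eq_natAbs, Int.natAbs_natCast] at h
    have hdodd : Odd d.natAbs := Int.natAbs_odd.mpr hd
    have hχd : χ (d : ZMod N) = χ (d.natAbs : ZMod N) := by
      rcases Int.natAbs_eq d with h | h
      · conv_lhs => rw [h]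
        rw [Int.cast_natCast]
      · conv_lhs => rw [h]
        rw [Int.cast_neg, Int.cast_natCast, ← neg_one_mul, map_mul, hχ.1, one_mul]
    rw [hχd, hval hd']
    have hd2 : d.natAbs % 2 = 1 := Nat.odd_iff.mp hdodd
    have hd13 : d.natAbs % 4 = 1 ∨ d.natAbs % 4 = 3 := by omega
    rw [show ((2 ^ b * q : ℕ) : ℤ) = 2 ^ b * (q : ℤ) by push_cast; ring, jacobiSym.mul_left,
      jacobiSym.pow_left, jacobiSym.at_two hdodd]
    rcases heven with ⟨ha0, hq1⟩ | ⟨ha1', hq3⟩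
    · rw [ha0, pow_zero, one_mul, jacobiSym.quadratic_reciprocity_one_mod_four hq1 hdodd]
    · rcases hd13 with hd1 | hd3
      · rw [ha1', pow_one, ZMod.χ₄_nat_one_mod_four hd1, one_mul,
          jacobiSym.quadratic_reciprocity_one_mod_four' hodd hd1]
      · rw [ha1', pow_one, ZMod.χ₄_nat_three_mod_four hd3,
          jacobiSym.quadratic_reciprocity_three_mod_four hq3 hd3]
        ring

end Summit.BirchSwinnertonDyer.Rank1Residual.ManinAdditive.SigmaEta
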